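/-
Copyright: the b2b-balaban T⁴-continuum CRUX team, row NE7b, leaf lineage `t4-ne7b-formalise-leaf-02` (gen 132). Project licence.
-/
import Summits.QuantumFields.BalabanUV.T4Continuum.Spine.NE7b.OneStepCovariantStokesValue
import Summits.QuantumFields.BalabanUV.T4Continuum.Spine.NE7b.RotatedSumRectangleStokes

/-!
# LEMMA CS AT ONE STEP, (i) + (ii) JOINED, BY VALUE: the covariant coarse curl of [B7]'s (125)-field `Q₀A` over a coarse plaquette, with
# respect to the averaged background `V̄₀`, is bounded by the block average of «`(1 + 2Lα₀)`·(the fine covariant curls in the block square) +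
# `2Lα₀`·(the 1-form on the square's interior rows) + `640(d+1)(d+4)L²α₀`·(the 1-form on three sides)» — for any structure group
# `ι : G →* 𝔸ˣ` into the unitaries of a C⋆-algebra reading the instance's `dist1`, and for the cell's `U(n) ⊂ M_n(ℂ)ˣ`
# (row NE7b, node U5c; `HOME/b2b-balaban-r1/SectE-interface-proof.md` §5.2 Lemma CS (i)–(ii) at `k = 1`; E-side key reading; the junction
# `…OneStepCovariantStokesValue` ∘ `…RotatedSumRectangleStokes`)

Cell `pub-balaban`, sub-cell `t4`, spine estimate NE7b (`T4WeightBudget.RelWeightBound`; the cell's OWN estimate — NOT PRINTED in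
[Bałaban 1983–89], NOT PROVED).  Crux-route work under `Spine/NE7b/` by the row's E-side ∕ key-readings ∕ lattice-geometry leaf lineage; a
[folklore] junction BY NAME of this lineage's `…OneStepCovariantStokesValue` (Lemma CS (ii) at `k = 1` by value: `norm_coarseCurl_Q0cov_bavg_le`),
`…RotatedSumRectangleStokes` (Lemma CS (i) at `k = 1` in [B7]'s currency: `norm_tsum_rectWord_le_of_dist1_le`, `toUnits_mem_U1`) and
`…OneStepCovariantStokes` (`norm_tsum_seg_le_sum`: the side sums); NOTHING of Bałaban's is asserted beyond what the imported modules prove; no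
`T4Continuum/Support` leaf typed; no `def`, no notation, no instance; zero `sorry`.

WHY (located).  The memo's Lemma CS at `k = 1` reads «`|(∂_V M_1A)(P)| ≤ Σ_{x∈B(y_P)} η^d Σ_{p∈S_x(P)} η²|F_A(p)|·(1 + ε_F) + c_g ε_F Σ_x η^d
Σ_{b∈∂S_x(P)} η|A(b)|`».  The two typed halves are: (ii) `…OneStepCovariantStokesValue` — the coarse curl against the rotated boundary sums
`Z_r = (R_{0,x_r}A)(∂S_{x_r}(P))` plus `2δ`·(three side sums), `δ = 320(d+1)(d+4)L²α₀`; (i) `…RotatedSumRectangleStokes` — `‖Z_r‖` against the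
fine covariant curls `F(y) = (R_{0,y}A)(∂p_{κμ}(y))` inside the block square plus `2(Lα₀)`·(row size budgets).  THIS FILE composes them and
books the HONEST SHAPE of the `k = 1` letter: besides the memo's boundary term, the curvature defect of step (i) weights the 1-form on the
INTERIOR ROWS of the block square (`Σ_{j<L}Σ_{i<L}‖A(x_r+je_μ+ie_κ, κ)‖` and the left column `Σ_{j<L}Σ_{i<j}‖A(x_r+ie_μ, μ)‖`) with the small
factor `2Lα₀` — the term the interior multiplicity `…BlockSquareRowMultiplicity` (`(d−1)L²` based squares per bond) was typed for — and the curls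
carry `(1 + 2Lα₀)` (the memo's `(1 + ε_F)`).

WHAT IS PROVED ([folklore]):
* §1 **`norm_coarseCurl_Q0cov_bavg_le_curls`** — GENERAL STRUCTURE GROUP: `𝔸` a non-trivial C⋆-algebra, `G` a `GaugeGroup`, `ι : G →* 𝔸ˣ`
  unitary-valued (`hιu`) with `‖ι g − 1‖ = dist1 g` (`hdist`), `U : bonds → G`, `V₀ = ι ∘ U` (`hV₀`), `‖V₀(∂p) − 1‖ ≤ α₀` on `ℤ^d` ((44)'s letter),
  `512(d+1)(d+4)L²α₀ ≤ 1`, `1 ≤ L`, a 1-form `A`, a coarse plaquette `P = (q; κ, μ)`, `κ ≠ μ`: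
  `‖(Q₀A)_{c₁} + R(V̄₀(c₁))(Q₀A)_{c₂} − R(V̄₀(c₁)V̄₀(c₂)V̄₀(c₃)⁻¹)(Q₀A)_{c₃} − R(…V̄₀(c₄)⁻¹)(Q₀A)_{c₄}‖ ≤ Σ_r L^{−(d+1)}·( (1 + 2Lα₀)·Σ_{j<L}Σ_{i<L}
  ‖F(x_r+ie_κ+je_μ)‖ + 2Lα₀·(Σ_{j<L}Σ_{i<j}‖A(x_r+ie_μ,μ)‖ + Σ_{j<L}Σ_{i<L}‖A(x_r+je_μ+ie_κ,κ)‖) + 2δ·(three side sums) )`, `x_r = q + boxVec L r`.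
* §2 **`norm_coarseCurl_Q0cov_bavg_le_curls_unitary`** — THE CELL's `U(n)`: the same for `U : bonds → U(n)`, `V₀ = Unitary.toUnits ∘ U`,
  `A` matrix-valued, operator norm (`RotatedSumRectangleStokes.toUnits_mem_U1`-style letters; `dist1 = ‖· − 1‖` by `rfl`).

NOT HERE (honest): the counting ∕ Cauchy–Schwarz of (5.2) and its `L²` ∕ `η` normalisation (`…CovariantStokesCounting`, `…BlockSurfaceCounting`,
`…BlockSquareRowMultiplicity` supply the counts; the two-scale torus vs `ℤ^d` periodisation is a later junction), (R-M) (`…OneStepAveragingRemainder`),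
(R-V), `k > 1`, any value of `ε_F`, `c_g` beyond the displayed products; WHICH `𝔸`, `G` are Bałaban's beyond «`U(N) ⊂ M_N(ℂ)`» ((A3) ∕ (A1c),
NC-NE7b-α UNRULED).  BY-NAME EFFECT ON THE WALL: NONE (the (h1) slot's `k = 1` letter by value; the wall is (R2)).  NE7b NOT PRINTED ∕ NOT PROVED;
spine PROVED 0∕9; rung (B)+1 on a FINITE torus — NOT infinite volume, NOT the mass gap, NOT Clay.
HONEST DEPENDENCY: continuum YM on T⁴ ⇐ BetaPertH ∧ nine spine estimates (0/9 proved); BetaPertH ⇐ (D1) ∧ (D4) ∧ CAP+tail; G-an2-4 gates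
asym, D1 and NE2/3/4.
-/

set_option autoImplicit false

noncomputable section

open scoped BigOperators
open Literature.MathematicalPhysics.QuantumFieldTheory.Balaban1983to89 (GaugeGroup dist1)
open Literature.MathematicalPhysics.QuantumFieldTheory.Balaban1983to89.B7Prop1Explicit (Site e hol seg treeWord boxVec bavg plaqWord U1)
open Literature.MathematicalPhysics.QuantumFieldTheory.Balaban1983to89.B7Prop2Explicit (unitaryUnits mem_unitaryUnits unitaryUnits_le_U1)
open Literature.MathematicalPhysics.QuantumFieldTheory.Balaban1983to89.B7Eq78Linearization (conjR)
open Literature.MathematicalPhysics.QuantumFieldTheory.Balaban1983to89.B7Prop3GeneralRotated (tsum)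
open Literature.MathematicalPhysics.QuantumFieldTheory.Balaban1983to89.B7Prop3GeneralLinear (Q0cov)
open Summit.QuantumFields.BalabanUV.T4Continuum.NE7b.NonAbelianStokesBound (rectWord)

namespace Summit.QuantumFields.BalabanUV.T4Continuum.NE7b.OneStepCoarseCurlBound

variable {d : ℕ}

/-! ## §1 General structure group `ι : G →* 𝔸ˣ` into the unitaries of a C⋆-algebra -/

section StructureGroup

variable {𝔸 : Type*} [CStarAlgebra 𝔸] [Nontrivial 𝔸] {G : Type*} [GaugeGroup G]
  (ι : G →* 𝔸ˣ) (hιu : ∀ g, ι g ∈ unitaryUnits 𝔸) (hdist : ∀ g, ‖((ι g : 𝔸ˣ) : 𝔸) - 1‖ = dist1 g)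
  (L : ℕ) (hL : 1 ≤ L) {α₀ : ℝ} (hα₀ : 0 ≤ α₀) (hsmall : 512 * (d + 1) * (d + 4) * (L : ℝ) ^ 2 * α₀ ≤ 1)
  (U : Site d → Fin d → G) {V₀ : Site d → Fin d → 𝔸ˣ} (hV₀ : ∀ y ν, V₀ y ν = ι (U y ν))
  (h44 : ∀ (x : Site d) (κ κ' : Fin d), κ ≠ κ' → ‖((hol V₀ x (plaqWord κ κ') : 𝔸ˣ) : 𝔸) - 1‖ ≤ α₀)

include hιu hdist hL hα₀ hsmall hV₀ h44 in
/-- **LEMMA CS AT `k = 1`, (i) + (ii) BY VALUE, GENERAL STRUCTURE GROUP.**  See the module docstring for the letters; the right side is the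
block average over `x_r = q + boxVec L r` of `(1 + 2Lα₀)·Σ_{j<L}Σ_{i<L}‖(R_{0,x_r+ie_κ+je_μ}A)(∂p_{κμ})‖ + 2Lα₀·(Σ_{j<L}Σ_{i<j}‖A(x_r+ie_μ,μ)‖ +
Σ_{j<L}Σ_{i<L}‖A(x_r+je_μ+ie_κ,κ)‖) + 2·320(d+1)(d+4)L²α₀·(three side sums)` — `OneStepCovariantStokesValue.norm_coarseCurl_Q0cov_bavg_le`, then per
block point `RotatedSumRectangleStokes.norm_tsum_rectWord_le_of_dist1_le` and `OneStepCovariantStokes.norm_tsum_seg_le_sum`. [folklore] -/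
theorem norm_coarseCurl_Q0cov_bavg_le_curls (A : Site d → Fin d → 𝔸) (q : Site d) {κ μ : Fin d} (hκμ : κ ≠ μ) :
    ‖Q0cov L V₀ A q κ + conjR (bavg L V₀ q κ) (Q0cov L V₀ A (q + (L : ℤ) • e κ) μ)
      - conjR (bavg L V₀ q κ * bavg L V₀ (q + (L : ℤ) • e κ) μ * (bavg L V₀ (q + (L : ℤ) • e μ) κ)⁻¹)
          (Q0cov L V₀ A (q + (L : ℤ) • e μ) κ)
      - conjR (bavg L V₀ q κ * bavg L V₀ (q + (L : ℤ) • e κ) μ * (bavg L V₀ (q + (L : ℤ) • e μ) κ)⁻¹ * (bavg L V₀ q μ)⁻¹)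
          (Q0cov L V₀ A q μ)‖
    ≤ ∑ r : Fin d → Fin L, ((L : ℝ) ^ (d + 1))⁻¹ *
        ( (1 + 2 * ((L : ℝ) * α₀))
            * ∑ j ∈ Finset.range L, ∑ i ∈ Finset.range L,
                ‖tsum V₀ A (q + boxVec L r + (i : ℤ) • e κ + (j : ℤ) • e μ) (plaqWord κ μ)‖
          + 2 * ((L : ℝ) * α₀)
            * ( ∑ j ∈ Finset.range L, ∑ i ∈ Finset.range j, ‖A (q + boxVec L r + (i : ℤ) • e μ) μ‖
              + ∑ j ∈ Finset.range L, ∑ i ∈ Finset.range L, ‖A (q + boxVec L r + (j : ℤ) • e μ + (i : ℤ) • e κ) κ‖ )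
          + 2 * (320 * (d + 1) * (d + 4) * (L : ℝ) ^ 2 * α₀)
            * ( ∑ i ∈ Finset.range L, ‖A (q + boxVec L r + (L : ℤ) • e κ + (i : ℤ) • e μ) μ‖
              + ∑ i ∈ Finset.range L, ‖A (q + boxVec L r + (L : ℤ) • e μ + (i : ℤ) • e κ) κ‖
              + ∑ i ∈ Finset.range L, ‖A (q + boxVec L r + (i : ℤ) • e μ) μ‖ ) ) := by
  have hV₀u : ∀ y ν, V₀ y ν ∈ unitaryUnits 𝔸 := fun y ν => by rw [hV₀]; exact hιu _
  have hV₀1 : ∀ y ν, V₀ y ν ∈ U1 𝔸 := fun y ν => unitaryUnits_le_U1 (hV₀u y ν)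
  have hU1 : ∀ g, ι g ∈ U1 𝔸 := fun g => unitaryUnits_le_U1 (hιu g)
  have hdist' : ∀ g, ‖((ι g : 𝔸ˣ) : 𝔸) - 1‖ ≤ dist1 g := fun g => (hdist g).le
  -- the curvature letter of the `(κ, μ)`-plane in the instance's `dist1`
  have hV : V₀ = fun y ν => ι (U y ν) := funext fun y => funext fun ν => hV₀ y ν
  have hαU : ∀ y : Site d, dist1 (hol U y (plaqWord κ μ)) ≤ α₀ := fun y => by
    rw [← hdist, LinearisedLatticeStokes.map_hol ι U y, ← hV]
    exact h44 y κ μ hκμ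
  have hLα : 0 ≤ (L : ℝ) * α₀ := by positivity
  -- step (ii) by value
  refine (OneStepCovariantStokesValue.norm_coarseCurl_Q0cov_bavg_le L hV₀u hL hα₀ hsmall h44 A q κ μ).trans
    (Finset.sum_le_sum fun r _ => mul_le_mul_of_nonneg_left ?_ (by positivity))
  refine add_le_add ?_ le_rfl
  -- step (i) at the block point `x_r`, then the side sums and the re-indexed curls
  have h1 := RotatedSumRectangleStokes.norm_tsum_rectWord_le_of_dist1_le ι hU1 hdist' U A hV₀ κ μ hαU (q + boxVec L r) L L
  have hT : ∀ j : ℕ, ‖tsum V₀ A (q + boxVec L r) (seg μ (j : ℤ))‖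
      ≤ ∑ i ∈ Finset.range j, ‖A (q + boxVec L r + (i : ℤ) • e μ) μ‖ := fun j =>
    OneStepCovariantStokes.norm_tsum_seg_le_sum hV₀1 A μ j (q + boxVec L r)
  have hF : ∑ j ∈ Finset.range L, ∑ i ∈ Finset.range L,
        ‖tsum V₀ A (q + boxVec L r + (j : ℤ) • e μ + (i : ℤ) • e κ) (plaqWord κ μ)‖
      = ∑ j ∈ Finset.range L, ∑ i ∈ Finset.range L,
        ‖tsum V₀ A (q + boxVec L r + (i : ℤ) • e κ + (j : ℤ) • e μ) (plaqWord κ μ)‖ := by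
    refine Finset.sum_congr rfl fun j _ => Finset.sum_congr rfl fun i _ => ?_
    rw [add_right_comm (q + boxVec L r) ((j : ℤ) • e μ)]
  have hsplit : ∑ j ∈ Finset.range L, (‖tsum V₀ A (q + boxVec L r) (seg μ (j : ℤ))‖
        + ∑ i ∈ Finset.range L, (‖A (q + boxVec L r + (j : ℤ) • e μ + (i : ℤ) • e κ) κ‖
          + ‖tsum V₀ A (q + boxVec L r + (j : ℤ) • e μ + (i : ℤ) • e κ) (plaqWord κ μ)‖))
      ≤ ∑ j ∈ Finset.range L, ∑ i ∈ Finset.range j, ‖A (q + boxVec L r + (i : ℤ) • e μ) μ‖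
        + ∑ j ∈ Finset.range L, ∑ i ∈ Finset.range L, ‖A (q + boxVec L r + (j : ℤ) • e μ + (i : ℤ) • e κ) κ‖
        + ∑ j ∈ Finset.range L, ∑ i ∈ Finset.range L,
            ‖tsum V₀ A (q + boxVec L r + (i : ℤ) • e κ + (j : ℤ) • e μ) (plaqWord κ μ)‖ := by
    rw [← hF, ← Finset.sum_add_distrib, ← Finset.sum_add_distrib]
    refine Finset.sum_le_sum fun j _ => ?_
    rw [Finset.sum_add_distrib]
    linarith [hT j]
  have h2 := mul_le_mul_of_nonneg_left hsplit (by positivity : (0 : ℝ) ≤ 2 * ((L : ℝ) * α₀))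
  linarith [h1, h2]

end StructureGroup

/-! ## §2 The cell's `U(n) ⊂ M_n(ℂ)ˣ`, operator norm -/

section UnitaryGroup

open scoped Matrix.Norms.L2Operator

variable {n : Type*} [Fintype n] [DecidableEq n] [Nonempty n]
  (L : ℕ) (hL : 1 ≤ L) {α₀ : ℝ} (hα₀ : 0 ≤ α₀) (hsmall : 512 * (d + 1) * (d + 4) * (L : ℝ) ^ 2 * α₀ ≤ 1)
  (U : Site d → Fin d → Matrix.unitaryGroup n ℂ) {V₀ : Site d → Fin d → (Matrix n n ℂ)ˣ}
  (hV₀ : ∀ y ν, V₀ y ν = Unitary.toUnits (U y ν))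
  (h44 : ∀ (x : Site d) (κ κ' : Fin d), κ ≠ κ' → ‖((hol V₀ x (plaqWord κ κ') : (Matrix n n ℂ)ˣ) : Matrix n n ℂ) - 1‖ ≤ α₀)

include hL hα₀ hsmall hV₀ h44 in
/-- **LEMMA CS AT `k = 1`, (i) + (ii) BY VALUE, ON THE CELL's `U(n)`** (`ι = Unitary.toUnits`, operator norm; `M_n(ℂ)` as a C⋆-algebra by
the scoped `Matrix.Norms.L2Operator` instances). [folklore] -/
theorem norm_coarseCurl_Q0cov_bavg_le_curls_unitary (A : Site d → Fin d → Matrix n n ℂ) (q : Site d) {κ μ : Fin d} (hκμ : κ ≠ μ) :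
    ‖Q0cov L V₀ A q κ + conjR (bavg L V₀ q κ) (Q0cov L V₀ A (q + (L : ℤ) • e κ) μ)
      - conjR (bavg L V₀ q κ * bavg L V₀ (q + (L : ℤ) • e κ) μ * (bavg L V₀ (q + (L : ℤ) • e μ) κ)⁻¹)
          (Q0cov L V₀ A (q + (L : ℤ) • e μ) κ)
      - conjR (bavg L V₀ q κ * bavg L V₀ (q + (L : ℤ) • e κ) μ * (bavg L V₀ (q + (L : ℤ) • e μ) κ)⁻¹ * (bavg L V₀ q μ)⁻¹)
          (Q0cov L V₀ A q μ)‖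
    ≤ ∑ r : Fin d → Fin L, ((L : ℝ) ^ (d + 1))⁻¹ *
        ( (1 + 2 * ((L : ℝ) * α₀))
            * ∑ j ∈ Finset.range L, ∑ i ∈ Finset.range L,
                ‖tsum V₀ A (q + boxVec L r + (i : ℤ) • e κ + (j : ℤ) • e μ) (plaqWord κ μ)‖
          + 2 * ((L : ℝ) * α₀)
            * ( ∑ j ∈ Finset.range L, ∑ i ∈ Finset.range j, ‖A (q + boxVec L r + (i : ℤ) • e μ) μ‖
              + ∑ j ∈ Finset.range L, ∑ i ∈ Finset.range L, ‖A (q + boxVec L r + (j : ℤ) • e μ + (i : ℤ) • e κ) κ‖ )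
          + 2 * (320 * (d + 1) * (d + 4) * (L : ℝ) ^ 2 * α₀)
            * ( ∑ i ∈ Finset.range L, ‖A (q + boxVec L r + (L : ℤ) • e κ + (i : ℤ) • e μ) μ‖
              + ∑ i ∈ Finset.range L, ‖A (q + boxVec L r + (L : ℤ) • e μ + (i : ℤ) • e κ) κ‖
              + ∑ i ∈ Finset.range L, ‖A (q + boxVec L r + (i : ℤ) • e μ) μ‖ ) ) := by
  letI : CStarAlgebra (Matrix n n ℂ) := {}
  have hιu : ∀ g : Matrix.unitaryGroup n ℂ, (Unitary.toUnits g : (Matrix n n ℂ)ˣ) ∈ unitaryUnits (Matrix n n ℂ) := fun g => by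
    rw [mem_unitaryUnits, Unitary.val_toUnits_apply]
    exact g.2
  have hdist : ∀ g : Matrix.unitaryGroup n ℂ, ‖((Unitary.toUnits g : (Matrix n n ℂ)ˣ) : Matrix n n ℂ) - 1‖ = dist1 g := fun g => by
    rw [Unitary.val_toUnits_apply, LinearisedLatticeStokesUnitary.dist1_unitaryGroup_eq]
  exact norm_coarseCurl_Q0cov_bavg_le_curls (Unitary.toUnits : Matrix.unitaryGroup n ℂ →* (Matrix n n ℂ)ˣ) hιu hdist L hL hα₀ hsmall
    U hV₀ h44 A q hκμ

end UnitaryGroup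

end Summit.QuantumFields.BalabanUV.T4Continuum.NE7b.OneStepCoarseCurlBound

end
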